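import Literature.MathematicalPhysics.QuantumChemistry.SecondQuantizedHamiltonian
import Literature.MathematicalPhysics.QuantumLattice.HubbardJordanWigner
import HarnessLib

/-!
# Ventures/CertifiedQuantumChemistry — Rows/JordanWignerWords.lean: the exact QC-MPO's ingredients in the kernel —
# every fermionic word is ONE product operator of site letters (FORMAT-qcmps0 §2, `word_of_ops`, for every number
# of orbitals), the molecular Hamiltonian is a finite sum of such words (the term list of §3), an MPO represents the
# sum over its bond-state paths (§3), and charge-labelled block-sparse words vanish off their sector (§1.2)

HONEST FRAMING (verbatim): certified bounds for a stated model Hamiltonian in a stated basis; not a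
claim about the real molecule beyond that model.

var-2 (gen 9), zero compute, PROVED glue only (0 sorry, no definition, no claim node, nothing here asserts a
bound about any model). The MPS upper certificates (`qc-upper-v0` with an MPS state, FORMAT-qcmps0; rows #114 /
#127 / #130 and the gated R2B-U / R3A-U rows) evaluate `⟨ψ|H_F|ψ⟩` by sweeping an EXACT matrix-product operator
(MPO) for `H_F` through the state (`Rows/SweepContraction.lean`: the sweep IS the configuration sum for the operator
whose configuration matrix elements are the MPO word products; `Rows/SweepErrorBudget.lean`: the floating-point /
interval evaluations of that sweep). Which operator those word products represent was, so far, "instance data checked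
outside the kernel" (FORMAT-qcmps0 §3: dense `4^k × 4^k` expansion = brute-force CAR matrix for `k ≤ 4`; lineage B′
termwise for `k ≤ 12`). This file puts the STRUCTURAL part of that statement in the kernel, for every `k`:

* §Words — FORMAT-qcmps0 §2 ("JW on sites: every `c`/`c†` is a Kronecker product of `4 × 4` integer matrices —
  `P = diag(1,-1,-1,1)` on earlier sites, the local letter on its site, `1` after; a product of operators is, site by
  site, the ordered product of factors (`hamiltonian.word_of_ops`)"): `toSpin_annihilation_eq_productOp`,
  `toSpin_creation_eq_productOp` (one operator = one product operator, letters as quoted, in the tree's site-major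
  Jordan–Wigner identification `JordanWigner.toSpin` with local basis `|0⟩,|α⟩,|β⟩,|αβ⟩`, `|αβ⟩ = c†_α c†_β |0⟩`, whose
  one-site letters `siteAnnihilation 0 = E₀₁ + E₂₃`, `siteAnnihilation 1 = E₀₂ − E₁₃`, `siteParity` are literally the
  quoted ones), `list_prod_map_productOp` (`productOp` is a monoid map: site by site the ordered product) and
  **`toSpin_ladderWord_eq_productOp`**: ANY word of creation / annihilation operators is ONE product operator whose
  letter at each site is the ordered product of the factors' letters there. No sign rule beyond the letters exists.
* §HamiltonianWords — the one-body word `c†_{xσ}c_{yτ}` and the two-body word `c†_{pσ}c†_{rτ}c_{sτ}c_{qσ}` as product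
  operators, and **`toSpin_molecularHamiltonian_eq_sum_productOp`**: the tree's second-quantised molecular
  Hamiltonian `molecularHamiltonian h g h_nuc = Σ_pq h_pq E_pq + ½ Σ_pqrs (pq|rs) e_pqrs + h_nuc` (T-05,
  `Literature/…/QuantumChemistry/SecondQuantizedHamiltonian`), read in the occupation basis, IS the finite sum over
  index tuples and spins of `integral • (one product operator)` plus `h_nuc • ⨂ 1` — the raw term list
  `Σ_t c_t ⨂_j w^t_j` of FORMAT-qcmps0 §3 before merging equal words (`terms_from_integrals`). With an orbital
  ordering `site_perm`, the same statement holds for the permuted integral tables (the chain is `Λ = Fin k` in site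
  order; nothing here depends on which orbital sits where).
* §Paths — `sum_mul_ofFn_prod_mul` / `ofFn_prod_apply_eq_sum_paths` (entries of an ordered matrix product as sums
  over paths, folklore) and **`of_ofFn_prod_apply_eq_sum_paths_productOp`**: on the chain `Fin N` with bond-state
  type `m` and site letters `W i x y` on the edge `x → y` of site `i`, the operator whose configuration matrix elements
  are the MPO word products `(W₀[σ₀,τ₀] ⋯ W_{N-1}[σ_{N-1},τ_{N-1}])[START, END]` — the object `Rows/SweepContraction`
  sweeps — equals `Σ_{paths START → END} ⨂_i W_i[π_i, π_{i+1}]`. So "MPO = H_F" is EXACTLY the bookkeeping claim that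
  the automaton's accepting paths enumerate the term list with its words and coefficients (FORMAT-qcmps0 §3: trie /
  complementary states, one `T → C` edge per term carrying `c_t`); that enumeration is the instance data which stays
  with the readers (`tests/test_mpo.py`, lineage B′), like every per-file fact of the cell.
* §SectorRule — **`ofFn_prod_apply_eq_zero_of_charge_ne`**: if every bond state carries an additive charge and every
  non-zero block entry raises the charge by the site's occupation (`qr = ql + occ(s)`, FORMAT-qcmps0 §1.2), a word
  product between bond states of charges `c₀`, `c_N` vanishes unless `c_N = c₀ + Σ_i occ(s_i)`: an MPS file passing
  the §1.2 checks is SYNTACTICALLY in its `(n_α, n_β)` sector (what `IsInSector` asks of an upper certificate's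
  vector) — by induction over sites, no numerics.
* §Letters — `siteParity_mul_siteAnnihilation` / `siteParity_mul_siteCreation`: `P c = −c P`, `P c† = −c† P` on one
  site (the letters are parity-odd), the identity behind the sign canonicalisation of letters in §3.

What is NOT claimed: no MPO automaton is constructed or verified here (see §Paths), no floating-point statement, no
row. Relation to the tree: `Literature/…/QuantumLattice/HubbardJordanWigner` has the single-operator dictionary
(`toSpin_annihilation = jwString x * onSite x (c_σ)`), two-operator hopping words and the Hubbard Hamiltonian in
spin language; new here are arbitrary words, the molecular (four-index) Hamiltonian's words, the path sum at the
operator level and the sector rule. References: P. Jordan, E. Wigner, Z. Phys. 47 (1928) 631; Essler–Frahm–Göhmann–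
Klümper–Korepin, *The One-Dimensional Hubbard Model* (2005) §12.3.4; U. Schollwöck, Ann. Phys. 326 (2011) 96, §5–§6
(MPO formalism); S. Keller, M. Dolfi, M. Troyer, M. Reiher, J. Chem. Phys. 143 (2015) 244118 and G. K.-L. Chan,
A. Keselman, N. Nakatani, Z. Li, S. R. White, J. Chem. Phys. 145 (2016) 014102 (the quantum-chemistry Hamiltonian as
an MPO / sum of operator strings); FORMAT-qcmps0 §1.2 / §2 / §3 (HOME `pub-qchem-var2/FORMAT-qcmps0.md`); qcmps
`hamiltonian.py`, `mpo.py`.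
-/

noncomputable section

namespace Summit.Ventures.CertifiedQuantumChemistry

open Matrix Finset
open Literature.MathematicalPhysics.QuantumLattice
open Literature.MathematicalPhysics.QuantumLattice.JordanWigner
open Literature.MathematicalPhysics.QuantumChemistry

section Words

variable {Λ : Type*} [LinearOrder Λ] [Fintype Λ]

/-- **Site by site, the ordered product of the factors.** A product of product operators is the product
operator of the site-wise ordered products of their letters (`productOp` is a monoid map; FORMAT-qcmps0 §2,
`hamiltonian.word_of_ops`). -/
theorem list_prod_map_productOp {q : ℕ} (ws : List (Λ → Matrix (Fin q) (Fin q) ℂ)) :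
    (ws.map productOp).prod = productOp fun y => (ws.map fun w => w y).prod := by
  induction ws with
  | nil => simp
  | cons w ws ih =>
    rw [List.map_cons, List.prod_cons, ih, productOp_mul]
    rfl

/-- **The Jordan–Wigner letters of an annihilator** (FORMAT-qcmps0 §2): `c_{xσ}` is the product operator with
the parity `P = diag(1,-1,-1,1)` on every EARLIER site `y < x`, the local letter `c_σ` at `x`, and `1` after. -/
theorem toSpin_annihilation_eq_productOp (x : Λ) (σ : Fin 2) :
    toSpin (annihilation (orb x σ)) =
      productOp fun y => if y < x then siteParity else if y = x then siteAnnihilation σ else 1 := by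
  rw [toSpin_annihilation, jwString, onSite_eq_productOp, productOp_mul]
  congr 1
  funext y
  by_cases h1 : y < x
  · rw [if_pos h1, if_pos h1, Function.update_of_ne (ne_of_lt h1), Matrix.mul_one]
  · by_cases h2 : y = x
    · subst h2
      rw [if_neg h1, if_neg h1, if_pos rfl, Function.update_self, Matrix.one_mul]
    · rw [if_neg h1, if_neg h1, if_neg h2, Function.update_of_ne h2, Matrix.mul_one]

/-- **The Jordan–Wigner letters of a creator** (FORMAT-qcmps0 §2): `c†_{xσ}` is the product operator with
`P` on every earlier site, the local letter `c†_σ = (c_σ)ᴴ` (`= (c_σ)ᵀ`, the entries being `0, ±1`) at `x`,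
and `1` after. -/
theorem toSpin_creation_eq_productOp (x : Λ) (σ : Fin 2) :
    toSpin (creation (orb x σ)) =
      productOp fun y => if y < x then siteParity else if y = x then siteCreation σ else 1 := by
  rw [toSpin_creation, jwString, onSite_eq_productOp, productOp_mul]
  congr 1
  funext y
  by_cases h1 : y < x
  · rw [if_pos h1, if_pos h1, Function.update_of_ne (ne_of_lt h1), Matrix.one_mul]
  · by_cases h2 : y = x
    · subst h2
      rw [if_neg h1, if_neg h1, if_pos rfl, Function.update_self, Matrix.mul_one]
    · rw [if_neg h1, if_neg h1, if_neg h2, Function.update_of_ne h2, Matrix.mul_one]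

/-- The letters of a general ladder letter `(i, dag)`, `i = (x, σ) ∈ Orb Λ`: `P` before the site of `i`, the
local letter (`c†_σ` if `dag`, else `c_σ`) at it, `1` after. -/
theorem toSpin_ladderLetter_eq_productOp (p : Orb Λ × Bool) :
    toSpin (ladderLetter p) =
      productOp fun y => if y < (ofLex p.1).1 then siteParity
        else if y = (ofLex p.1).1 then (if p.2 then siteCreation (ofLex p.1).2 else siteAnnihilation (ofLex p.1).2)
        else 1 := by
  obtain ⟨i, b⟩ := p
  have hi : i = orb (ofLex i).1 (ofLex i).2 := rfl
  cases b
  · simp only [ladderLetter, if_false, Bool.false_eq_true]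
    rw [hi, toSpin_annihilation_eq_productOp]
    rfl
  · simp only [ladderLetter, if_true]
    rw [hi, toSpin_creation_eq_productOp]
    rfl

/-- **`word_of_ops` (FORMAT-qcmps0 §2), for every number of orbitals.** Any word `a₁ ⋯ aₙ` of creation /
annihilation operators, read in the site-major occupation basis `|0⟩,|α⟩,|β⟩,|αβ⟩` per site, is ONE product
operator: at each site the ordered product of the letters of `a₁, …, aₙ` at that site (`P` for every operator
acting on a later site, the local `c` / `c†` letter for every operator acting on this site, `1` otherwise). No
sign rule beyond the letters is involved. -/
theorem toSpin_ladderWord_eq_productOp (l : List (Orb Λ × Bool)) :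
    toSpin (ladderWord l) =
      productOp fun y => (l.map fun p : Orb Λ × Bool =>
        if y < (ofLex p.1).1 then siteParity
        else if y = (ofLex p.1).1 then
          (if p.2 then siteCreation (ofLex p.1).2 else siteAnnihilation (ofLex p.1).2)
        else (1 : Matrix (Fin 4) (Fin 4) ℂ)).prod := by
  induction l with
  | nil =>
    rw [ladderWord_nil, map_one]
    simp only [List.map_nil, List.prod_nil]
    exact productOp_one.symm
  | cons p l ih =>
    rw [ladderWord_cons, map_mul, ih, toSpin_ladderLetter_eq_productOp, productOp_mul]
    simp only [List.map_cons, List.prod_cons]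

end Words

/-! ## The words of the molecular Hamiltonian -/

section HamiltonianWords

variable {Λ : Type*} [LinearOrder Λ] [Fintype Λ]

/-- **One-body word** `c†_{xσ} c_{yτ}`: the product operator whose letter at site `z` is
`(P | c†_σ | 1)_z · (P | c_τ | 1)_z` (first factor by `z < x` / `z = x` / `z > x`, second by `y`). -/
theorem toSpin_creation_mul_annihilation_eq_productOp (x y : Λ) (σ τ : Fin 2) :
    toSpin (creation (orb x σ) * annihilation (orb y τ)) =
      productOp fun z =>
        (if z < x then siteParity else if z = x then siteCreation σ else 1) *
        (if z < y then siteParity else if z = y then siteAnnihilation τ else 1) := by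
  rw [map_mul, toSpin_creation_eq_productOp, toSpin_annihilation_eq_productOp, productOp_mul]

/-- **Two-body word** `c†_{pσ} c†_{rτ} c_{sτ} c_{qσ}` (the operator string of the `(pq|rs)` term of an FCIDUMP
Hamiltonian): the product operator whose letter at each site is the ordered product of the four letters. -/
theorem toSpin_twoBodyWord_eq_productOp (p q r s : Λ) (σ τ : Fin 2) :
    toSpin (creation (orb p σ) * creation (orb r τ) * annihilation (orb s τ) * annihilation (orb q σ)) =
      productOp fun z =>
        (if z < p then siteParity else if z = p then siteCreation σ else 1) *
        (if z < r then siteParity else if z = r then siteCreation τ else 1) *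
        (if z < s then siteParity else if z = s then siteAnnihilation τ else 1) *
        (if z < q then siteParity else if z = q then siteAnnihilation σ else 1) := by
  rw [map_mul, map_mul, map_mul, toSpin_creation_eq_productOp, toSpin_creation_eq_productOp,
    toSpin_annihilation_eq_productOp, toSpin_annihilation_eq_productOp, productOp_mul, productOp_mul,
    productOp_mul]

/-- **The molecular Hamiltonian as a sum of Jordan–Wigner words (FORMAT-qcmps0 §2–§3).** Read in the
site-major occupation basis, `Ĥ = Σ_pq h_pq E_pq + ½ Σ_pqrs (pq|rs) e_pqrs + h_nuc` is the finite sum, over the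
integral index tuples and spins, of the integral times ONE product operator of site letters, plus `h_nuc` times
the empty word `⨂_z 1`: the term list `Σ_t c_t ⨂_j w^t_j` from which the exact MPO is assembled. -/
theorem toSpin_molecularHamiltonian_eq_sum_productOp (h : Λ → Λ → ℂ) (g : Λ → Λ → Λ → Λ → ℂ) (hnuc : ℂ) :
    toSpin (molecularHamiltonian h g hnuc) =
      ∑ p : Λ, ∑ q : Λ, h p q • ∑ σ : Fin 2, productOp (fun z =>
          (if z < p then siteParity else if z = p then siteCreation σ else 1) *
          (if z < q then siteParity else if z = q then siteAnnihilation σ else 1)) +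
      (1 / 2 : ℂ) • ∑ p : Λ, ∑ q : Λ, ∑ r : Λ, ∑ s : Λ, g p q r s • ∑ σ : Fin 2, ∑ τ : Fin 2,
          productOp (fun z =>
            (if z < p then siteParity else if z = p then siteCreation σ else 1) *
            (if z < r then siteParity else if z = r then siteCreation τ else 1) *
            (if z < s then siteParity else if z = s then siteAnnihilation τ else 1) *
            (if z < q then siteParity else if z = q then siteAnnihilation σ else 1)) +
      hnuc • productOp (fun _ : Λ => (1 : Matrix (Fin 4) (Fin 4) ℂ)) := by
  rw [molecularHamiltonian_eq, productOp_one]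
  simp only [map_add, map_sum, map_smul, map_one, toSpin_creation_mul_annihilation_eq_productOp,
    toSpin_twoBodyWord_eq_productOp]

end HamiltonianWords

/-! ## An MPO represents the sum, over its bond-state paths, of the product operators of the edge letters -/

section Paths

variable {m : Type*} [Fintype m] [DecidableEq m]

/-- **Bilinear path-sum formula** for an ordered product of matrices:
`Σ_{s,t} u_s (M₀ ⋯ M_{N-1})_{st} v_t = Σ_π u_{π₀} (∏_k M_k(π_k, π_{k+1})) v_{π_N}` over paths `π : Fin (N+1) → m`.
[folklore] (adapted from `Summits/HubbardSuperconductivity/HubbardLadder/Bounds/TracePathExpansion.lean`,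
`sum_mul_listProd_mul_eq`, re-proved here to keep the cell's import closure inside its own topic) -/
theorem sum_mul_ofFn_prod_mul {R : Type*} [CommRing R] {N : ℕ} (M : Fin N → Matrix m m R) (u v : m → R) :
    ∑ s, ∑ t, u s * (List.ofFn M).prod s t * v t =
      ∑ π : Fin (N + 1) → m, u (π 0) * (∏ k : Fin N, M k (π (Fin.castSucc k)) (π k.succ)) * v (π (Fin.last N)) := by
  induction N generalizing u with
  | zero =>
    simp only [List.ofFn_zero, List.prod_nil, Finset.univ_eq_empty, Finset.prod_empty, mul_one]
    rw [Fintype.sum_equiv (Equiv.funUnique (Fin 1) m)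
      (fun π : Fin 1 → m => u (π 0) * v (π (Fin.last 0))) (fun s => u s * v s) (fun π => rfl)]
    refine Finset.sum_congr rfl fun s _ => ?_
    simp only [Matrix.one_apply, mul_ite, mul_one, mul_zero, ite_mul, zero_mul, Finset.sum_ite_eq,
      Finset.mem_univ, if_true]
  | succ N ih =>
    rw [List.ofFn_succ, List.prod_cons]
    have hL : ∑ s, ∑ t, u s * (M 0 * (List.ofFn fun i : Fin N => M i.succ).prod) s t * v t =
        ∑ r, ∑ t, (∑ s, u s * M 0 s r) * (List.ofFn fun i : Fin N => M i.succ).prod r t * v t := by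
      simp only [Matrix.mul_apply, Finset.mul_sum, Finset.sum_mul]
      calc ∑ s, ∑ t, ∑ r, u s * (M 0 s r * (List.ofFn fun i : Fin N => M i.succ).prod r t) * v t
          = ∑ s, ∑ r, ∑ t, u s * M 0 s r * (List.ofFn fun i : Fin N => M i.succ).prod r t * v t := by
            refine Finset.sum_congr rfl fun s _ => ?_
            rw [Finset.sum_comm]
            exact Finset.sum_congr rfl fun r _ => Finset.sum_congr rfl fun t _ => by ring
        _ = ∑ r, ∑ s, ∑ t, u s * M 0 s r * (List.ofFn fun i : Fin N => M i.succ).prod r t * v t :=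
            Finset.sum_comm
        _ = ∑ r, ∑ t, ∑ s, u s * M 0 s r * (List.ofFn fun i : Fin N => M i.succ).prod r t * v t :=
            Finset.sum_congr rfl fun r _ => Finset.sum_comm
    rw [hL, ih (fun i => M i.succ) fun r => ∑ s, u s * M 0 s r]
    rw [Fintype.sum_equiv (Fin.consEquiv fun _ : Fin (N + 2) => m).symm
      (fun π : Fin (N + 2) → m => u (π 0) * (∏ k : Fin (N + 1), M k (π (Fin.castSucc k)) (π k.succ)) *
        v (π (Fin.last (N + 1))))
      (fun p => u p.1 * (∏ k : Fin (N + 1), M k ((Fin.cons p.1 p.2 : Fin (N + 2) → m) (Fin.castSucc k))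
        ((Fin.cons p.1 p.2 : Fin (N + 2) → m) k.succ)) *
        v ((Fin.cons p.1 p.2 : Fin (N + 2) → m) (Fin.last (N + 1))))
      (fun π => by
        rw [show (Fin.consEquiv fun _ : Fin (N + 2) => m).symm π = (π 0, Fin.tail π) from rfl,
          Fin.cons_self_tail]),
      Fintype.sum_prod_type, Finset.sum_comm]
    refine Finset.sum_congr rfl fun π _ => ?_
    rw [Finset.sum_mul, Finset.sum_mul]
    refine Finset.sum_congr rfl fun a _ => ?_
    have hlast : (Fin.cons a π : Fin (N + 2) → m) (Fin.last (N + 1)) = π (Fin.last N) := by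
      rw [← Fin.succ_last, Fin.cons_succ]
    have hcons : ∏ k : Fin (N + 1), M k ((Fin.cons a π : Fin (N + 2) → m) (Fin.castSucc k))
        ((Fin.cons a π : Fin (N + 2) → m) k.succ) =
        M 0 a (π 0) * ∏ k : Fin N, M k.succ (π (Fin.castSucc k)) (π k.succ) := by
      rw [Fin.prod_univ_succ]
      simp only [Fin.castSucc_zero, Fin.cons_zero, Fin.cons_succ, ← Fin.succ_castSucc]
    dsimp only
    rw [hcons, hlast]
    ring

/-- **Entries of an ordered product as a sum over paths with fixed end points**:
`(M₀ ⋯ M_{N-1})_{x y} = Σ_{π : π₀ = x, π_N = y} ∏_k M_k(π_k, π_{k+1})`. [folklore] -/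
theorem ofFn_prod_apply_eq_sum_paths {R : Type*} [CommRing R] {N : ℕ} (M : Fin N → Matrix m m R)
    (x y : m) :
    (List.ofFn M).prod x y = ∑ π : Fin (N + 1) → m,
      if π 0 = x ∧ π (Fin.last N) = y then ∏ k : Fin N, M k (π (Fin.castSucc k)) (π k.succ) else 0 := by
  have h := sum_mul_ofFn_prod_mul M (fun s => if s = x then 1 else 0) (fun t => if t = y then 1 else 0)
  simp only [ite_mul, one_mul, zero_mul, mul_ite, mul_one, mul_zero, Finset.sum_ite_eq', Finset.mem_univ,
    if_true] at h
  rw [h]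
  refine Finset.sum_congr rfl fun π _ => ?_
  by_cases h0 : π 0 = x <;> by_cases h1 : π (Fin.last N) = y <;> simp [h0, h1]

/-- **An MPO is the sum over its bond-state paths of the product operators of its edge letters.** On the chain
of sites `Fin N` with one bond-state type `m` at every bond (zero-padding, as in `Rows/SweepContraction.lean`),
let `W i x y` be the `q × q` site letter on the edge `x → y` of site `i`. The operator whose configuration
matrix elements are the MPO word products `(W₀[σ₀,τ₀] ⋯ W_{N-1}[σ_{N-1},τ_{N-1}])[x₀, y₀]` (the object
`Rows/SweepContraction.lean` evaluates between two matrix-product states) equals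
`Σ_{π : π₀ = x₀, π_N = y₀} ⨂_i W_i[π_i, π_{i+1}]`: one product operator per path of bond states from `x₀` (START)
to `y₀` (END). Hence an MPO whose accepting paths are in bijection with a term list, the letters along the path of
term `t` being its word `w^t` with the coefficient `c_t` on one edge, represents `Σ_t c_t ⨂_j w^t_j`
(FORMAT-qcmps0 §3, "by induction the contraction is `Σ_t c_t ⊗_j w^t_j`"); which paths a given automaton has is
instance bookkeeping, checked outside the kernel (`tests/test_mpo.py`, lineage B′). -/
theorem of_ofFn_prod_apply_eq_sum_paths_productOp {N q : ℕ} (W : Fin N → m → m → Matrix (Fin q) (Fin q) ℂ)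
    (x₀ y₀ : m) :
    (Matrix.of fun σ τ : TensorIndex (Fin N) q =>
        (List.ofFn fun i : Fin N => (Matrix.of fun x y : m => W i x y (σ i) (τ i))).prod x₀ y₀) =
      ∑ π : Fin (N + 1) → m, if π 0 = x₀ ∧ π (Fin.last N) = y₀ then
        productOp (fun i : Fin N => W i (π (Fin.castSucc i)) (π i.succ)) else 0 := by
  ext σ τ
  rw [Matrix.of_apply, ofFn_prod_apply_eq_sum_paths, Matrix.sum_apply]
  refine Finset.sum_congr rfl fun π _ => ?_
  split_ifs with h
  · rw [productOp_apply]
    rfl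
  · rfl

end Paths

/-! ## The sector rule: charge-labelled block-sparse words vanish off the sector (FORMAT-qcmps0 §1.2) -/

section SectorRule

variable {D : Type*} [Fintype D] [DecidableEq D] {C : Type*} [AddCommMonoid C] {R : Type*} [CommRing R]

/-- Telescoping along a chain: `c_{i+1} = c_i + w_i` for all `i < N` gives `c_N = c_0 + Σ_i w_i`. [folklore] -/
private theorem apply_last_eq_add_sum {N : ℕ} (c : Fin (N + 1) → C) (w : Fin N → C)
    (h : ∀ i : Fin N, c i.succ = c (Fin.castSucc i) + w i) : c (Fin.last N) = c 0 + ∑ i, w i := by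
  induction N with
  | zero => simp
  | succ N ih =>
    have h1 := ih (fun i => c (Fin.castSucc i)) (fun i => w (Fin.castSucc i)) (fun i => by
      rw [← Fin.succ_castSucc]
      exact h (Fin.castSucc i))
    rw [← Fin.succ_last, h (Fin.last N), h1, Fin.castSucc_zero, Fin.sum_univ_castSucc, add_assoc]

/-- **The sector rule (FORMAT-qcmps0 §1.2), by induction over sites.** Let `A i : Matrix D D R` be one matrix per
site (for an MPS amplitude: the block-assembled site tensor `A_i^{s_i}` at the configuration's local state `s_i`),
let every bond state carry a charge `c i x` in an additive monoid (the `(n_α, n_β)` labels of the bond sectors) and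
let `w i` be the charge added at site `i` (`occ(s_i) ∈ {(0,0),(1,0),(0,1),(1,1)}`). If every NON-ZERO entry
respects the labels, `A i x y ≠ 0 → c (i+1) y = c i x + w i` (blocks exist only for `qr = ql + occ(s)`), then the
word product `(A₀ ⋯ A_{N-1})[x₀, y₀]` vanishes unless `c N y₀ = c 0 x₀ + Σ_i w_i`. With bond `0 = {(0,0)}` and bond
`N = {(n_a, n_b)}` this is: the amplitude `ψ(s)` vanishes unless `Σ_i occ(s_i) = (n_a, n_b)` — the state is
SYNTACTICALLY in the `(n_a, n_b)` sector, which is what `IsInSector` asks of an upper certificate's vector; no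
numerics are involved. -/
theorem ofFn_prod_apply_eq_zero_of_charge_ne {N : ℕ} (A : Fin N → Matrix D D R) (c : Fin (N + 1) → D → C)
    (w : Fin N → C) (hA : ∀ (i : Fin N) (x y : D), A i x y ≠ 0 → c i.succ y = c (Fin.castSucc i) x + w i)
    {x₀ y₀ : D} (h : c (Fin.last N) y₀ ≠ c 0 x₀ + ∑ i, w i) :
    (List.ofFn A).prod x₀ y₀ = 0 := by
  rw [ofFn_prod_apply_eq_sum_paths]
  refine Finset.sum_eq_zero fun π _ => ?_
  split_ifs with hπ
  · by_contra hne
    have hall : ∀ i : Fin N, A i (π (Fin.castSucc i)) (π i.succ) ≠ 0 := fun i hi =>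
      hne (Finset.prod_eq_zero (Finset.mem_univ i) hi)
    apply h
    rw [← hπ.1, ← hπ.2]
    exact apply_last_eq_add_sum (fun j => c j (π j)) w fun i => hA i _ _ (hall i)
  · rfl

end SectorRule

/-! ## Letter algebra: the parity anticommutes with the odd letters -/

section Letters

/-- `P c_↑ = − c_↑ P` (explicit `4 × 4` check). -/
private theorem siteParity_mul_siteAnnihilation_zero :
    siteParity * siteAnnihilation 0 = -(siteAnnihilation 0 * siteParity) := by
  rw [siteParity_eq, siteAnnihilation_zero_eq]
  ext a b
  fin_cases a <;> fin_cases b <;> simp [Matrix.mul_apply, Fin.sum_univ_four]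

/-- `P c_↓ = − c_↓ P` (explicit `4 × 4` check). -/
private theorem siteParity_mul_siteAnnihilation_one :
    siteParity * siteAnnihilation 1 = -(siteAnnihilation 1 * siteParity) := by
  rw [siteParity_eq, siteAnnihilation_one_eq]
  ext a b
  fin_cases a <;> fin_cases b <;> simp [Matrix.mul_apply, Fin.sum_univ_four]

/-- `P c_σ = − c_σ P` on one site (the local letters are parity-odd), so moving parities through a word's
letters only changes its sign (the sign canonicalisation of FORMAT-qcmps0 §3). -/
theorem siteParity_mul_siteAnnihilation (σ : Fin 2) :
    siteParity * siteAnnihilation σ = -(siteAnnihilation σ * siteParity) := by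
  fin_cases σ
  · exact siteParity_mul_siteAnnihilation_zero
  · exact siteParity_mul_siteAnnihilation_one

/-- `P c†_σ = − c†_σ P` on one site. -/
theorem siteParity_mul_siteCreation (σ : Fin 2) :
    siteParity * siteCreation σ = -(siteCreation σ * siteParity) := by
  have h := congrArg Matrix.conjTranspose (siteParity_mul_siteAnnihilation σ)
  rw [conjTranspose_mul, conjTranspose_neg, conjTranspose_mul, siteParity_conjTranspose] at h
  rw [siteCreation, h, neg_neg]

end Letters

end Summit.Ventures.CertifiedQuantumChemistry
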